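import Mathlib
import Literature.Analysis.FluidPDE.Tao2016AveragedNS.ShiftSetCascadeFlows
import Literature.Analysis.FluidPDE.Tao2016AveragedNS.ShiftSetCascadeFlux
import Summits.NavierStokesRegularity.NavierStokesRegularity.Theorems.TaoLadderRungTwoFlatMirrorTableDefs
import HarnessLib

/-!
# The explicit two-species window field of the mirror-seeded Toda table on `S♭`
  (helper for item stmt-NavierStokesRegularity-22987 `FlatGapCertificatesV2`, crux K_A♭ of route
  TaoLadderRungTwoFlat; cell harvest/h2-tao-ladder, p1 g14)

For the numerics side (theory-1 NUM-T41, the A♭ window certificate at `ε₀ = 1/4`) and for any future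
kernel-replayed validated integration, the nonlinearity `quadTermOn shiftSetFlat ε₀ (mirrorTable ε δ)`
must be available in CLOSED FORM. Writing `a_n := S 0 n`, `v_n := S 1 n` and `c_n := (1+ε₀)^{5n/2}`:

* carrier: `quadTermOn S♭ ε₀ (mirrorTable ε δ) S 0 n t
    = c_{n-1} (v_{n-1}² + δ a_n v_{n-1}) − c_n (v_n² + ε a_n v_n)`,
* bond:    `quadTermOn S♭ ε₀ (mirrorTable ε δ) S 1 n t
    = c_n (a_n v_n + ε a_n² − a_{n+1} v_n − δ a_{n+1}²)`,

(`quadTermOn_mirrorTable_carrier`, `quadTermOn_mirrorTable_bond`), and the bond-flux table size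
`coeffAbsOn (botShifts S♭) (mirrorTable ε δ) = 1 + |δ|` (`= 3/2` at `δ = 1/2`, the constant `C♭` of the
nine scalar checks of `CertificateGlueOn.stub_rung_quarter_of_checks`).

HONEST FRAMING: identities about a MODEL lattice nonlinearity (Tao 2016 §4 vocabulary, shift set `S♭`);
nothing is certified here and nothing is a statement about the Navier–Stokes equations.
-/

noncomputable section

-- the sub-problem namespace repeats the summit name by design (D-0017)
set_option linter.dupNamespace false

namespace Summit.NavierStokesRegularity.NavierStokesRegularity.Theorems

open Literature.Analysis.FluidPDE Literature.Analysis.FluidPDE.TaoCascade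

namespace MirrorField

/-- A sum over `S♭` is the sum of its seven terms. [cite: Tao2016AveragedNS, §4 after (4.1) (the shift set); cell vocabulary] -/
theorem sum_shiftSetFlat {M : Type*} [AddCommMonoid M] (f : ℤ × ℤ × ℤ → M) :
    ∑ μ ∈ shiftSetFlat, f μ =
      f (0, 0, 0) + f (1, 0, 0) + f (0, 1, 0) + f (0, 0, 1) + f (1, 1, 0) + f (1, 0, 1) + f (0, 1, 1) := by
  simp [shiftSetFlat, Finset.sum_insert, add_assoc]

/-- **Carrier equation** of the mirror-seeded Toda table on `S♭`:
`ȧ_n = c_{n-1}(v_{n-1}² + δ a_n v_{n-1}) − c_n(v_n² + ε a_n v_n)`, `c_n = (1+ε₀)^{5n/2}`.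
[cite: Tao2016AveragedNS, §4 (4.8) (the quadratic nonlinearity); route TaoLadderRungTwoFlat, posited table] -/
theorem quadTermOn_mirrorTable_carrier (ε₀ ε δ : ℝ) (S : Fin 2 → ℤ → ℝ → ℝ) (n : ℤ) (t : ℝ) :
    quadTermOn shiftSetFlat ε₀ (mirrorTable ε δ) S 0 n t =
      (1 + ε₀) ^ ((5 : ℝ) * (n - 1) / 2) * (S 1 (n - 1) t ^ 2 + δ * (S 0 n t * S 1 (n - 1) t)) -
        (1 + ε₀) ^ ((5 : ℝ) * n / 2) * (S 1 n t ^ 2 + ε * (S 0 n t * S 1 n t)) := by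
  simp only [quadTermOn, Fin.sum_univ_two, sum_shiftSetFlat, mirrorTable]
  norm_num
  ring

/-- **Bond equation** of the mirror-seeded Toda table on `S♭`:
`v̇_n = c_n (a_n v_n + ε a_n² − a_{n+1} v_n − δ a_{n+1}²)`, `c_n = (1+ε₀)^{5n/2}`.
[cite: Tao2016AveragedNS, §4 (4.8) (the quadratic nonlinearity); route TaoLadderRungTwoFlat, posited table] -/
theorem quadTermOn_mirrorTable_bond (ε₀ ε δ : ℝ) (S : Fin 2 → ℤ → ℝ → ℝ) (n : ℤ) (t : ℝ) :
    quadTermOn shiftSetFlat ε₀ (mirrorTable ε δ) S 1 n t =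
      (1 + ε₀) ^ ((5 : ℝ) * n / 2) *
        (S 0 n t * S 1 n t + ε * S 0 n t ^ 2 - S 0 (n + 1) t * S 1 n t - δ * S 0 (n + 1) t ^ 2) := by
  simp only [quadTermOn, Fin.sum_univ_two, sum_shiftSetFlat, mirrorTable]
  norm_num
  ring

/-- The bond-output shifts of `S♭` are `(0,0,1), (1,0,1), (0,1,1)`.
[cite: Tao2016AveragedNS, §4 proof of Lemma 4.1 (v); cell vocabulary, shift-set parametrised] -/
theorem botShifts_shiftSetFlat : botShifts shiftSetFlat = {(0, 0, 1), (1, 0, 1), (0, 1, 1)} := by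
  decide

/-- **Bond-flux table size** of the mirror-seeded Toda table: `C♭(ε, δ) = 1 + |δ|`.
[cite: Tao2016AveragedNS, §4 (4.1) (structure constants); route TaoLadderRungTwoFlat, posited table] -/
theorem coeffAbsOn_botShifts_mirrorTable (ε δ : ℝ) :
    coeffAbsOn (botShifts shiftSetFlat) (mirrorTable ε δ) = 1 + |δ| := by
  rw [coeffAbsOn, botShifts_shiftSetFlat]
  simp only [Fin.sum_univ_two, mirrorTable]
  norm_num [Finset.sum_insert, abs_div]
  ring

/-- `C♭ = coeffAbsOn (botShifts S♭) (mirrorTable ½ ½) = 3/2` — the constant of checks A₂–A₅ of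
`CertificateGlueOn.stub_rung_quarter_of_checks`. [cite: Tao2016AveragedNS, §4 (4.1); route TaoLadderRungTwoFlat, stub_rung_quarter] -/
theorem coeffAbsOn_botShifts_mirrorTable_half :
    coeffAbsOn (botShifts shiftSetFlat) (mirrorTable (1 / 2) (1 / 2)) = 3 / 2 := by
  rw [coeffAbsOn_botShifts_mirrorTable]
  norm_num [abs_of_pos]

end MirrorField

end Summit.NavierStokesRegularity.NavierStokesRegularity.Theorems

end
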